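import Summits.QuantumFields.YangMills.Theorems.BalabanUVNodesN08HaarCompatibilityGuardReparam

/-!
# BalabanUVNodes ∕ N08 — THE FIBRE MAP OF THE CENTRAL REPARAMETRISATION `Ψ` AT ONE COARSE BOND, ITS BLINDNESS TO THE CENTRAL COORDINATES, AND
# RESAMPLING OF ONE PRIVATE COORDINATE (generic group, any small-loop average; the lemmas of part 12)

WIDTH SEAT `pub-ymgap-dag-n08-w3` g3, plan `W-SEAT-START-LIST.md` v8 §n08 item 3 PART 12A (generic half of part 12, split by topic at the 400-line lint; successor
piece of part 8 p597554 `…GuardReparam`), 2026-08-28.  Track A, DAG node N08 = [Balaban1985UV3] Thm 1 p. 257 (compact) + Thm 2 p. 272; key item K1⁷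
`StabilityBAtRecordR13SepCoPH` (stmt-QuantumFields-20542), `--supports … --as helper`.  COUNT-NEUTRAL.

THE POINT.  Part 8 wrote the typed (0.4) averaging as `Ū = axial ∘ Ψ` with `Ψ U = (b ↦ extend β (c ↦ pre⁻¹·corr·pre) 1 b · U b)` (inline, no object) and
offered `Ψ_*(dU) = dU` as a sufficient condition for the typed E6′ letter (road (iv)).  To DECIDE road (iv) (part 12B refutes it) one needs three structural
facts about `Ψ`, all [folklore] over `BlockAveragingHaarAC` FACT (A) (a central crossing bond on a loop ∕ half-line of `c₀` is `β(c₀)`):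
(1) RESAMPLING (§1, pure measure theory): for a probability measure `μ`, `(U, g) ↦ U[b₀ ↦ g]` is measure preserving `μ^ι ⊗ μ → μ^ι` (box computation,
    `Measure.pi_eq`) — so `dU`-measures of sets and of their `Ψ`-preimages become `dU ⊗ Haar`-integrals over (background, private coordinate).
(2) THE FIBRE MAP (§2): `(Ψ U[β(c₀) ↦ g])(β(c₀)) = pre(U)⁻¹ · Ū(c₀)(U[β(c₀) ↦ g]) · post(U)⁻¹` (`reparam_update_apply_centralBond`), and this is BLIND to every
    central coordinate of `U` (`fibre_congr`: `pre`, `post`, the loop family and hence `Ū(c₀)` read only non-central coordinates and `U(β(c₀))`).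
(3) THE RESET `Π U := U[β(c) ↦ 1, all c]` (§2, written inline as the left multiplication `b ↦ extend β (c ↦ U(β c)⁻¹) 1 b · U b`): `Π ∘ Ψ = Π`
    (`reset_reparam`), `Π (U[β(c₀) ↦ g]) = Π U` (`reset_update`), `φ(Π U, ·) = φ(U, ·)` (`fibre_reset`), `Π 1 = 1`, `Π` measurable; `φ` jointly measurable.

HONEST FRAMING.  Lattice ∕ measure-theoretic bookkeeping about the typed (0.4) averaging; nothing of Bałaban's asserted; decides nothing by itself (part 12B
does); count-neutral; N08 NOT discharged; counts unmoved (typed 28∕28 · discharged 5∕27); one finite 𝕋⁴ programme at fixed ε — R4 closes the CONDITIONAL rung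
`BalabanLadder.UV` only; the Yang–Mills mass gap (Clay) is NOT proved by any of this; nothing continuum ∕ ℝ³ ∕ ℝ⁴ ∕ OS ∕ mass gap.  0 `sorry`, 0 `def`,
0 `instance`, standard axioms.
-/

noncomputable section

open MeasureTheory Function

namespace Summit.QuantumFields.YangMills.BalabanUVNodes.N08HaarCompatibilityGuardReparamFibre

open Literature.MathematicalPhysics.QuantumFieldTheory.Balaban1983to89
open Literature.MathematicalPhysics.QuantumFieldTheory.Balaban1983to89.T4Continuum
open Literature.MathematicalPhysics.QuantumFieldTheory.Balaban1983to89.T4ReflectionCone (holAt_congr)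
open Literature.MathematicalPhysics.QuantumFieldTheory.Balaban1983to89.AveragingRT (axialAvg)
open Literature.MathematicalPhysics.QuantumFieldTheory.Balaban1983to89.BlockAveraging
  (Idx loopHol Small corr avgFun measurable_avgFun)
open Literature.MathematicalPhysics.QuantumFieldTheory.Balaban1983to89.BlockAveragingHaarAC
  (centralBond centralBond_injective pre post axialAvg_eq_pre_mul_mul_post axialAvg_update_centralBond pre_update post_update
    eq_of_mem_walk_loopWord_of_eq_centralBond)
open Summit.QuantumFields.YangMills.BalabanUVNodes.N08HaarCompatibilityGuardReparam
  (ne_centralBond_of_mem_walk_pre ne_centralBond_of_mem_walk_post extend_centralBond_apply extend_centralBond_apply_of_forall_ne measurable_reparam)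

/-! ## §1. Resampling one coordinate preserves the product law -/

section Resample

variable {ι : Type*} [Fintype ι] [DecidableEq ι] {G : Type*} [MeasurableSpace G]

/-- **RESAMPLING ONE COORDINATE PRESERVES THE PRODUCT LAW**: for a probability measure `μ`, replacing the coordinate `b₀` of `U ∼ μ^ι` by a fresh independent
`g ∼ μ` leaves the law unchanged — `(U, g) ↦ U[b₀ ↦ g]` is measure preserving `μ^ι ⊗ μ → μ^ι` (box computation, `Measure.pi_eq`). [folklore] -/
theorem measurePreserving_update (μ : Measure G) [IsProbabilityMeasure μ] (b₀ : ι) :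
    MeasurePreserving (fun p : (ι → G) × G => update p.1 b₀ p.2) ((Measure.pi fun _ : ι => μ).prod μ) (Measure.pi fun _ : ι => μ) := by
  have hm : Measurable (fun p : (ι → G) × G => update p.1 b₀ p.2) := measurable_update'
  refine ⟨hm, (Measure.pi_eq fun s hs => ?_).symm⟩
  rw [Measure.map_apply hm (MeasurableSet.univ_pi hs)]
  have hpre : (fun p : (ι → G) × G => update p.1 b₀ p.2) ⁻¹' Set.univ.pi s = (Set.univ.pi (update s b₀ Set.univ)) ×ˢ s b₀ := by
    ext ⟨U, g⟩
    simp only [Set.mem_preimage, Set.mem_univ_pi, Set.mem_prod]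
    constructor
    · intro h
      refine ⟨fun i => ?_, by simpa using h b₀⟩
      by_cases hi : i = b₀
      · subst hi; simp
      · simpa [update_of_ne hi] using h i
    · rintro ⟨hU, hg⟩ i
      by_cases hi : i = b₀
      · subst hi; simpa using hg
      · simpa [update_of_ne hi] using hU i
  rw [hpre, Measure.prod_prod, Measure.pi_pi]
  have h1 : (∏ i, μ (update s b₀ Set.univ i)) = ∏ i ∈ Finset.univ \ {b₀}, μ (s i) := by
    rw [Finset.prod_eq_mul_prod_sdiff_singleton_of_mem (Finset.mem_univ b₀) (fun i => μ (update s b₀ Set.univ i)), update_self, measure_univ, one_mul]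
    exact Finset.prod_congr rfl fun i hi => by
      rw [update_of_ne (by simpa using hi)]
  rw [h1, Finset.prod_eq_mul_prod_sdiff_singleton_of_mem (Finset.mem_univ b₀) (fun i => μ (s i)), mul_comm]

end Resample

/-! ## §2. The fibre map of `Ψ` at `c₀` and its blindness to the central coordinates -/

section Fibre

variable {P : Params} {j : ℕ} {G : Type*} [GaugeGroup G] (ℰ : LoopAverage G)

/-- **THE FIBRE MAP OF `Ψ` AT `c₀`**: `(Ψ U[β(c₀) ↦ g])(β(c₀)) = pre(U)⁻¹ · Ū(c₀)(U[β(c₀) ↦ g]) · post(U)⁻¹` (`pre`, `post` free of the private coordinate,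
`Ū(c₀) = corr · pre · g · post`). [cite: Balaban1987RG1, (0.4) p.253 (bookkeeping)] -/
theorem reparam_update_apply_centralBond (hj : j + 1 ≤ P.m + P.K) (U : GaugeField P j G) (c₀ : PBond P (j + 1)) (g : G) :
    (fun b => Function.extend centralBond
        (fun c => (pre (update U (centralBond c₀) g) c)⁻¹ * corr ℰ (update U (centralBond c₀) g) c * pre (update U (centralBond c₀) g) c)
        (fun _ => (1 : G)) b * update U (centralBond c₀) g b) (centralBond c₀) =
      (pre U c₀)⁻¹ * avgFun ℰ (update U (centralBond c₀) g) c₀ * (post U c₀)⁻¹ := by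
  show _ * _ = (pre U c₀)⁻¹ * (corr ℰ _ c₀ * axialAvg _ c₀) * (post U c₀)⁻¹
  rw [extend_centralBond_apply hj, pre_update hj, update_self, axialAvg_update_centralBond hj]
  group

/-- **`Ψ` FIXES EVERY NON-CENTRAL COORDINATE.** [cite: Balaban1987RG1, (0.4) p.253 (bookkeeping)] -/
theorem reparam_apply_of_forall_ne (U : GaugeField P j G) {b : PBond P j} (hb : ∀ c, b ≠ centralBond c) :
    Function.extend centralBond (fun c => (pre U c)⁻¹ * corr ℰ U c * pre U c) (fun _ => (1 : G)) b * U b = U b := by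
  rw [extend_centralBond_apply_of_forall_ne _ hb, one_mul]

omit ℰ in
/-- `pre` reads only non-central coordinates: it agrees on two configurations that agree off `range β` (standing range). [folklore] -/
theorem pre_congr (hj : j + 1 ≤ P.m + P.K) {U U' : GaugeField P j G} (h : ∀ b, (∀ c, b ≠ centralBond c) → U b = U' b) (c₀ : PBond P (j + 1)) :
    pre U c₀ = pre U' c₀ :=
  holAt_congr fun s hs => h s.bond fun c => ne_centralBond_of_mem_walk_pre hj c₀ c hs

omit ℰ in
/-- `post` reads only non-central coordinates. [folklore] -/
theorem post_congr (hj : j + 1 ≤ P.m + P.K) {U U' : GaugeField P j G} (h : ∀ b, (∀ c, b ≠ centralBond c) → U b = U' b) (c₀ : PBond P (j + 1)) :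
    post U c₀ = post U' c₀ :=
  holAt_congr fun s hs => h s.bond fun c => ne_centralBond_of_mem_walk_post hj c₀ c hs

omit ℰ in
/-- The loop family of `c₀` reads only the non-central coordinates and `U(β(c₀))` (FACT (A): a central bond on a loop of `c₀` is `β(c₀)`). [folklore] -/
theorem loopHol_congr (hj : j + 1 ≤ P.m + P.K) {U U' : GaugeField P j G} (h : ∀ b, (∀ c, b ≠ centralBond c) → U b = U' b)
    (c₀ : PBond P (j + 1)) (h₀ : U (centralBond c₀) = U' (centralBond c₀)) : loopHol U c₀ = loopHol U' c₀ := by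
  funext i
  refine holAt_congr fun s hs => ?_
  by_cases hb : ∃ c, s.bond = centralBond c
  · obtain ⟨c, hc⟩ := hb
    rw [hc, eq_of_mem_walk_loopWord_of_eq_centralBond hj c₀ c i hs hc]
    exact h₀
  · exact h s.bond fun c hc => hb ⟨c, hc⟩

/-- **`Ū(c₀)` READS ONLY THE NON-CENTRAL COORDINATES AND `U(β(c₀))`.** [cite: Balaban1987RG1, (0.4) p.253 (bookkeeping)] -/
theorem avgFun_congr (hj : j + 1 ≤ P.m + P.K) {U U' : GaugeField P j G} (h : ∀ b, (∀ c, b ≠ centralBond c) → U b = U' b)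
    (c₀ : PBond P (j + 1)) (h₀ : U (centralBond c₀) = U' (centralBond c₀)) : avgFun ℰ U c₀ = avgFun ℰ U' c₀ := by
  show corr ℰ U c₀ * axialAvg U c₀ = corr ℰ U' c₀ * axialAvg U' c₀
  unfold corr BlockAveraging.Small
  rw [loopHol_congr hj h c₀ h₀, axialAvg_eq_pre_mul_mul_post, axialAvg_eq_pre_mul_mul_post, pre_congr hj h, post_congr hj h, h₀]

/-- **THE FIBRE MAP IS BLIND TO THE CENTRAL COORDINATES**: `φ(U, g) = φ(U′, g)` whenever `U`, `U′` agree off `range β`. [cite: Balaban1987RG1, (0.4) p.253 (bookkeeping)] -/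
theorem fibre_congr (hj : j + 1 ≤ P.m + P.K) {U U' : GaugeField P j G} (h : ∀ b, (∀ c, b ≠ centralBond c) → U b = U' b)
    (c₀ : PBond P (j + 1)) (g : G) :
    (pre U c₀)⁻¹ * avgFun ℰ (update U (centralBond c₀) g) c₀ * (post U c₀)⁻¹ =
      (pre U' c₀)⁻¹ * avgFun ℰ (update U' (centralBond c₀) g) c₀ * (post U' c₀)⁻¹ := by
  have h' : ∀ b, (∀ c, b ≠ centralBond c) → update U (centralBond c₀) g b = update U' (centralBond c₀) g b := fun b hb => by
    rw [update_of_ne (hb c₀), update_of_ne (hb c₀), h b hb]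
  rw [pre_congr hj h, post_congr hj h, avgFun_congr ℰ hj h' c₀ (by rw [update_self, update_self])]

/-! ### The reset `Π U := U[β(c) ↦ 1, all c]`, written as a left multiplication -/

omit ℰ in
/-- `Π U (β c) = 1` (standing range: `β` injective). [folklore] -/
theorem reset_apply_centralBond (hj : j + 1 ≤ P.m + P.K) (U : GaugeField P j G) (c : PBond P (j + 1)) :
    Function.extend centralBond (fun c => (U (centralBond c))⁻¹) (fun _ => (1 : G)) (centralBond c) * U (centralBond c) = 1 := by
  rw [extend_centralBond_apply hj, inv_mul_cancel]

omit ℰ in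
/-- `Π U b = U b` off `range β`. [folklore] -/
theorem reset_apply_of_forall_ne (U : GaugeField P j G) {b : PBond P j} (hb : ∀ c, b ≠ centralBond c) :
    Function.extend centralBond (fun c => (U (centralBond c))⁻¹) (fun _ => (1 : G)) b * U b = U b := by
  rw [extend_centralBond_apply_of_forall_ne _ hb, one_mul]

omit ℰ in
/-- `Π U = Π U′` whenever `U`, `U′` agree off `range β` (standing range). [folklore] -/
theorem reset_congr (hj : j + 1 ≤ P.m + P.K) {U U' : GaugeField P j G} (h : ∀ b, (∀ c, b ≠ centralBond c) → U b = U' b) :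
    (fun b => Function.extend centralBond (fun c => (U (centralBond c))⁻¹) (fun _ => (1 : G)) b * U b) =
      fun b => Function.extend centralBond (fun c => (U' (centralBond c))⁻¹) (fun _ => (1 : G)) b * U' b := by
  funext b
  by_cases hb : ∃ c, b = centralBond c
  · obtain ⟨c, rfl⟩ := hb
    rw [reset_apply_centralBond hj, reset_apply_centralBond hj]
  · have hb' : ∀ c, b ≠ centralBond c := fun c hc => hb ⟨c, hc⟩
    rw [reset_apply_of_forall_ne U hb', reset_apply_of_forall_ne U' hb', h b hb']

omit ℰ in
/-- `Π (U[β(c₀) ↦ g]) = Π U`. [folklore] -/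
theorem reset_update (hj : j + 1 ≤ P.m + P.K) (U : GaugeField P j G) (c₀ : PBond P (j + 1)) (g : G) :
    (fun b => Function.extend centralBond (fun c => (update U (centralBond c₀) g (centralBond c))⁻¹) (fun _ => (1 : G)) b * update U (centralBond c₀) g b) =
      fun b => Function.extend centralBond (fun c => (U (centralBond c))⁻¹) (fun _ => (1 : G)) b * U b :=
  reset_congr hj fun _ hb => update_of_ne (hb c₀) _ _

/-- **`Π ∘ Ψ = Π`** (`Ψ` touches only central coordinates). [cite: Balaban1987RG1, (0.4) p.253 (bookkeeping)] -/
theorem reset_reparam (hj : j + 1 ≤ P.m + P.K) (U : GaugeField P j G) :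
    (fun b => Function.extend centralBond
        (fun c => ((fun b => Function.extend centralBond (fun c => (pre U c)⁻¹ * corr ℰ U c * pre U c) (fun _ => (1 : G)) b * U b) (centralBond c))⁻¹)
        (fun _ => (1 : G)) b *
        (fun b => Function.extend centralBond (fun c => (pre U c)⁻¹ * corr ℰ U c * pre U c) (fun _ => (1 : G)) b * U b) b) =
      fun b => Function.extend centralBond (fun c => (U (centralBond c))⁻¹) (fun _ => (1 : G)) b * U b :=
  reset_congr hj fun _ hb => reparam_apply_of_forall_ne ℰ U hb

omit ℰ in
/-- `Π 1 = 1`. [folklore] -/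
theorem reset_one : (fun b => Function.extend centralBond (fun c => ((1 : GaugeField P j G) (centralBond c))⁻¹) (fun _ => (1 : G)) b * (1 : GaugeField P j G) b) =
    (1 : GaugeField P j G) := by
  funext b
  show _ * 1 = (1 : G)
  rw [mul_one, show (fun c : PBond P (j + 1) => ((1 : GaugeField P j G) (centralBond c))⁻¹) = fun _ => (1 : G) from funext fun _ => inv_one, Function.extend_def]
  split_ifs <;> rfl

/-- **THE FIBRE MAP AT `U` IS THE FIBRE MAP AT `Π U`.** [cite: Balaban1987RG1, (0.4) p.253 (bookkeeping)] -/
theorem fibre_reset (hj : j + 1 ≤ P.m + P.K) (U : GaugeField P j G) (c₀ : PBond P (j + 1)) (g : G) :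
    (pre (fun b => Function.extend centralBond (fun c => (U (centralBond c))⁻¹) (fun _ => (1 : G)) b * U b) c₀)⁻¹ *
        avgFun ℰ (update (fun b => Function.extend centralBond (fun c => (U (centralBond c))⁻¹) (fun _ => (1 : G)) b * U b) (centralBond c₀) g) c₀ *
          (post (fun b => Function.extend centralBond (fun c => (U (centralBond c))⁻¹) (fun _ => (1 : G)) b * U b) c₀)⁻¹ =
      (pre U c₀)⁻¹ * avgFun ℰ (update U (centralBond c₀) g) c₀ * (post U c₀)⁻¹ :=
  fibre_congr ℰ hj (fun _ hb => reset_apply_of_forall_ne U hb) c₀ g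

variable [MeasurableSpace G] [RegularGaugeGroup G]

omit ℰ in
/-- `Π` is measurable. [folklore] -/
theorem measurable_reset : Measurable (β := GaugeField P j G) fun (U : GaugeField P j G) b =>
    Function.extend centralBond (fun c => (U (centralBond c))⁻¹) (fun _ => (1 : G)) b * U b := by
  classical
  refine measurable_pi_lambda _ fun b => Measurable.mul ?_ (measurable_pi_apply b)
  simp only [Function.extend_def]
  split_ifs
  · exact (measurable_pi_apply _).inv
  · exact measurable_const

/-- The fibre map `(U, g) ↦ φ(U, g)` is (jointly) measurable for a measurable small-loop average. [folklore] -/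
theorem measurable_fibre (hE : ∀ n, Measurable fun W : Fin (n + 1) → G => ℰ.E W) (c₀ : PBond P (j + 1)) :
    Measurable fun p : GaugeField P j G × G => (pre p.1 c₀)⁻¹ * avgFun ℰ (update p.1 (centralBond c₀) p.2) c₀ * (post p.1 c₀)⁻¹ := by
  have hpre : Measurable fun p : GaugeField P j G × G => pre p.1 c₀ := (T4Continuum.measurable_holAt _).comp measurable_fst
  have hpost : Measurable fun p : GaugeField P j G × G => post p.1 c₀ := (T4Continuum.measurable_holAt _).comp measurable_fst
  have hav : Measurable fun p : GaugeField P j G × G => avgFun ℰ (update p.1 (centralBond c₀) p.2) c₀ :=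
    (measurable_pi_apply c₀).comp ((measurable_avgFun ℰ hE).comp measurable_update')
  exact (hpre.inv.mul hav).mul hpost.inv

end Fibre

end Summit.QuantumFields.YangMills.BalabanUVNodes.N08HaarCompatibilityGuardReparamFibre

end
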